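import Summits.Langlands.Langlands.Theses.TowerDoorSplit
import Literature.NumberTheory.Automorphic.CaraianiNewtonModularity
import Literature.NumberTheory.Automorphic.ThorneQInfinityModular
import Literature.NumberTheory.Automorphic.AbelianTotallyRealModularity
/-! BC3 birth skeleton for crux `FifteenStableCoverWitnessAutomorphy` (B5) of node/route `TowerDoorSplit` (lens-5 g19): 6 named stubs (sorry) + ONE closed composition `FifteenStableCoverWitnessAutomorphy_proof` (real proof below the `have` lines). POST-BIRTH form: imports the route file and concludes the ROUTE decl by name (elaborates once Theses/TowerDoorSplit.lean exists). -/
set_option linter.dupNamespace false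
set_option linter.unusedVariables false
open scoped BigOperators Topology Manifold Classical MeasureTheory ProbabilityTheory Matrix InnerProductSpace ComplexConjugate ContinuousMap
open Filter Set Function TopologicalSpace MeasureTheory
-- SKELETON SHAPE (writer-1 WORD (A)(61), bus L1461): ONE closed theorem `<Crux>_proof : <crux decl>` whose `have` lines invoke the sorried stubs; no stub is typed `… → <crux decl>`.
namespace Summit.Langlands.Langlands.Cruxes.FifteenStableCoverWitnessAutomorphy.Birth

/-- THE RELATIVE DOOR AT 15 (load-bearing, PRINT by proof — Yoshikawa 2022 arXiv:2206.12860 Cor 3.6 (1) [corpus:paper-arxiv-2206.12860 p5] with «real quadratic F, ℤ_p-layer» replaced by «any subfield F, any odd-degree K₀/F»; ingredients Thorne 2016 Thm 7.6 = tree fact `Thorne2019_thm2_five` (√5 ∉ K ∧ ρ̄₅ irreducible ⇒ modular), FLS 2015 Thm 3 = `FLS2015_theorem3`, the moduli interpretation of X₀(15) = `Thorne2019.E₁` and X(s3,b5) = `Thorne2019.E₂`, Cor 3.3 (1): odd degree ⇒ no growth on E₂ either, via the 2-isogeny): over a totally real K₀ with √5 ∉ K₀, [K₀:F] odd and X₀(15)(K₀)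 = X₀(15)(F), every integral E/𝓞_{K₀} is modular OR j(E) ∈ F (instance-free: c₄³ = q·Δ, q ∈ F). -/
theorem stub_door15 :
    ∀ (K₀ : Type) [Field K₀] [NumberField K₀], NumberField.IsTotallyReal K₀ → ¬ IsSquare (5 : K₀) → ∀ F : IntermediateField ℚ K₀, Odd (Module.finrank F K₀) → (∀ x y : K₀, (Literature.NumberTheory.Automorphic.Thorne2019.E₁.baseChange K₀).toAffine.Equation x y → x ∈ Set.range (algebraMap F K₀) ∧ y ∈ Set.range (algebraMap F K₀)) → ∀ E : WeierstrassCurve (NumberField.RingOfIntegers K₀), E.Δ ≠ 0 → Literature.NumberTheory.Automorphic.IsModularEllipticCurve K₀ E ∨ ∃ q : F, (E.baseChange K₀).c₄ ^ 3 = algebraMap F K₀ q * (E.baseChange K₀).Δ := by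
  sorry

/-- SOLVABLE TWIST DESCENT (PRINT: Langlands 1980 cyclic base change = tree fact `baseChange_cyclic_cuspidal`, Arthur–Clozel 1989 = `ArthurClozel1989_weakLifting_cuspidal`, iterated through a cyclic prime-degree tower of the solvable Galois K₀/F — cuspidality is automatic at odd steps and at quadratic steps holds unless E acquires CM, which lands in the `HasCM` disjunct; then a quadratic twist over K₀: E ≅_{K̄} E₀ ⊗ K₀ with E₀/F of the same j): K₀ totally real, Galois and solvable over a subfield F, every curve over every TR field of degree [F:ℚ] modular ⇒ every integral E/𝓞_{K₀} with j(E) ∈ F modular.  Degree-free; shared by B5 and B7. -/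
theorem stub_twistDescent :
    ∀ (K₀ : Type) [Field K₀] [NumberField K₀], NumberField.IsTotallyReal K₀ → ∀ F : IntermediateField ℚ K₀, IsGalois F K₀ → IsSolvable (K₀ ≃ₐ[F] K₀) → (∀ (K : Type) [Field K] [NumberField K], NumberField.IsTotallyReal K → Module.finrank ℚ K = Module.finrank ℚ F → ∀ E₀ : WeierstrassCurve (NumberField.RingOfIntegers K), E₀.Δ ≠ 0 → Literature.NumberTheory.Automorphic.IsModularEllipticCurve K E₀) → ∀ E : WeierstrassCurve (NumberField.RingOfIntegers K₀), E.Δ ≠ 0 → (∃ q : F, (E.baseChange K₀).c₄ ^ 3 = algebraMap F K₀ q * (E.baseChange K₀).Δ) → Literature.NumberTheory.Automorphic.IsModularEllipticCurve K₀ E := by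
  sorry

/-- THE BASE RANGE (= the host rungs `EllipticDegreeLadder.SubquarticModularity` ∧ `QuarticModularity` ∧ `QuinticModularity` jointly, kernel-checked both ways in the node: `TowerDoorSplit.baseRange_of_rungs` / `rungs_of_baseRange`; PRINT: Wiles/BCDT, Freitas–Le Hung–Siksek 2015, Derickx–Najman–Siksek 2020, Box 2022, Ishitsuka–Ito–Yoshikawa 2022/25): every integral curve (Δ ≠ 0) over every totally real field of degree ≤ 5 is modular. -/
theorem stub_baseRange :
    ∀ (K : Type) [Field K] [NumberField K], NumberField.IsTotallyReal K → Module.finrank ℚ K ≤ 5 → ∀ E : WeierstrassCurve (NumberField.RingOfIntegers K), E.Δ ≠ 0 → Literature.NumberTheory.Automorphic.IsModularEllipticCurve K E := by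
  sorry

/-- ETP = this route's support item `TowerDoorSplit.EllipticTransportPointwise` (BY NAME in the post-birth form, so the item is in the skeleton-aware cone of `closes` — BC6; text in the pre-birth form; text IDENTICAL to route-Langlands-CMRestImageLocusSplit's item of the same name — dedup by signature): the host transport TRANY 31038 with the witness taken through an integral model and only ITS modularity assumed.  PRINT: Arthur–Clozel solvable descent/base change + GL₁-twist + cyclic automorphic induction + strong multiplicity one, exactly as TRANY. -/
theorem stub_transport :
    Summit.Langlands.Langlands.Theses.TowerDoorSplit.EllipticTransportPointwise := by
  sorry

/-- W⁺|₂ = host item `EllipticDegreeLadder.SatakeAvatarExistence` (stmt-Langlands-17415) AT n = 2, text VERBATIM the first antecedent of TRANY 31038 / ETP: every L-algebraic cuspidal π on GL₂/K has an irreducible ℓ-adic Galois avatar matching its Satake parameters a.e. (HLTT/Scholze + purity; over TR/CM fields print, in general open) — closes with the host item (`TowerDoorSplit.avatarTwo_of_satakeAvatarExistence`). -/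
theorem stub_avatar2 :
    ∀ (K : Type) [Field K] [NumberField K] (hcpt : Literature.NumberTheory.Automorphic.isCompact_glFiniteIntegralLevel 2 K) (π : Literature.NumberTheory.Automorphic.CuspidalAutomorphicRepData 2 K hcpt), π.1.IsLAlgebraic → ∀ (ℓ : ℕ) [Fact ℓ.Prime] (ι : PadicAlgCl ℓ ≃+* ℂ), ∃ ρ : Literature.NumberTheory.GaloisRepresentations.FramedGaloisRep K (PadicAlgCl ℓ) 2, ρ.toGaloisRep.IsIrreducible ∧ ∀ᶠ v : IsDedekindDomain.HeightOneSpectrum (NumberField.RingOfIntegers K) in Filter.cofinite, SatakeFrobCompatibleAt ι π.1 ρ v := by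
  sorry

/-- R1 = host item `EllipticDegreeLadder.RankOneAutomorphy` (stmt-Langlands-24805) BY NAME (cross-route by-name stub, tree precedent `stub_pairLBoundaryJS : AnalyticDescent.PairLBoundaryJS`) — automorphy of pinned-geometric ℓ-adic characters (class field theory + Weil); one proof closes both. -/
theorem stub_rankOne :
    Summit.Langlands.Langlands.Theses.EllipticDegreeLadder.RankOneAutomorphy := by
  sorry

/-- composition (real proof, no sorry outside the stubs): the stubs imply the cell. -/
theorem FifteenStableCoverWitnessAutomorphy_proof :
    Summit.Langlands.Langlands.Theses.TowerDoorSplit.FifteenStableCoverWitnessAutomorphy := by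
  have hD : (∀ (K₀ : Type) [Field K₀] [NumberField K₀], NumberField.IsTotallyReal K₀ → ¬ IsSquare (5 : K₀) → ∀ F : IntermediateField ℚ K₀, Odd (Module.finrank F K₀) → (∀ x y : K₀, (Literature.NumberTheory.Automorphic.Thorne2019.E₁.baseChange K₀).toAffine.Equation x y → x ∈ Set.range (algebraMap F K₀) ∧ y ∈ Set.range (algebraMap F K₀)) → ∀ E : WeierstrassCurve (NumberField.RingOfIntegers K₀), E.Δ ≠ 0 → Literature.NumberTheory.Automorphic.IsModularEllipticCurve K₀ E ∨ ∃ q : F, (E.baseChange K₀).c₄ ^ 3 = algebraMap F K₀ q * (E.baseChange K₀).Δ) := stub_door15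
  have hS : (∀ (K₀ : Type) [Field K₀] [NumberField K₀], NumberField.IsTotallyReal K₀ → ∀ F : IntermediateField ℚ K₀, IsGalois F K₀ → IsSolvable (K₀ ≃ₐ[F] K₀) → (∀ (K : Type) [Field K] [NumberField K], NumberField.IsTotallyReal K → Module.finrank ℚ K = Module.finrank ℚ F → ∀ E₀ : WeierstrassCurve (NumberField.RingOfIntegers K), E₀.Δ ≠ 0 → Literature.NumberTheory.Automorphic.IsModularEllipticCurve K E₀) → ∀ E : WeierstrassCurve (NumberField.RingOfIntegers K₀), E.Δ ≠ 0 → (∃ q : F, (E.baseChange K₀).c₄ ^ 3 = algebraMap F K₀ q * (E.baseChange K₀).Δ) → Literature.NumberTheory.Automorphic.IsModularEllipticCurve K₀ E) := stub_twistDescent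
  have hB : (∀ (K : Type) [Field K] [NumberField K], NumberField.IsTotallyReal K → Module.finrank ℚ K ≤ 5 → ∀ E : WeierstrassCurve (NumberField.RingOfIntegers K), E.Δ ≠ 0 → Literature.NumberTheory.Automorphic.IsModularEllipticCurve K E) := stub_baseRange
  have hT : (Summit.Langlands.Langlands.Theses.TowerDoorSplit.EllipticTransportPointwise) := stub_transport
  have hW : (∀ (K : Type) [Field K] [NumberField K] (hcpt : Literature.NumberTheory.Automorphic.isCompact_glFiniteIntegralLevel 2 K) (π : Literature.NumberTheory.Automorphic.CuspidalAutomorphicRepData 2 K hcpt), π.1.IsLAlgebraic → ∀ (ℓ : ℕ) [Fact ℓ.Prime] (ι : PadicAlgCl ℓ ≃+* ℂ), ∃ ρ : Literature.NumberTheory.GaloisRepresentations.FramedGaloisRep K (PadicAlgCl ℓ) 2, ρ.toGaloisRep.IsIrreducible ∧ ∀ᶠ v : IsDedekindDomain.HeightOneSpectrum (NumberField.RingOfIntegers K) in Filter.cofinite, SatakeFrobCompatibleAt ι π.1 ρ v) := stub_avatar2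
  have h1 : (Summit.Langlands.Langlands.Theses.EllipticDegreeLadder.RankOneAutomorphy) := stub_rankOne
  intro K _ _ hcpt ℓ _ ι ρ hirr hgeo htw hP
  obtain ⟨-, -, -, L, _, _, _, hgal, hsol, K₀, _, _, _, hgal₀, hsol₀, hTR, ⟨h5, F, hF5, hGalF, hSolvF, hOdd, hPts⟩, E, hEll, χ, hvia⟩ := hP
  have hΔ : E.Δ ≠ 0 := by
    intro h0
    have hu := (E.baseChange K₀).isUnit_Δ
    simp only [WeierstrassCurve.baseChange, WeierstrassCurve.map_Δ, h0, map_zero, isUnit_zero_iff] at hu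
    exact zero_ne_one hu
  have hbase : ∀ (K' : Type) [Field K'] [NumberField K'], NumberField.IsTotallyReal K' → Module.finrank ℚ K' = Module.finrank ℚ F →
      ∀ E₀ : WeierstrassCurve (NumberField.RingOfIntegers K'), E₀.Δ ≠ 0 → Literature.NumberTheory.Automorphic.IsModularEllipticCurve K' E₀ :=
    fun K' _ _ hTR' hdeg E₀ hΔ₀ => hB K' hTR' (by omega) E₀ hΔ₀
  have hmod : Literature.NumberTheory.Automorphic.IsModularEllipticCurve K₀ E := by
    rcases hD K₀ hTR h5 F hOdd hPts E hΔ with hm | hj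
    · exact hm
    · exact hS K₀ hTR F hGalF hSolvF hbase E hΔ hj
  exact hT hW h1 K hcpt ℓ ι ρ hirr hgeo htw L hgal hsol K₀ hgal₀ hsol₀ E χ hvia hmod

end Summit.Langlands.Langlands.Cruxes.FifteenStableCoverWitnessAutomorphy.Birth
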